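import Literature.RepresentationTheory.HeisenbergGroup.SchrodingerLeraySectionSmooth
import HarnessLib

/-!
# The value at the origin of a Leray-normalised section, conjugated onto the Siegel parabolic

Topic `RepresentationTheory/HeisenbergGroup`; namespace `Literature.RepresentationTheory.HeisenbergGroup`. KERNEL
mathematics only (theorems; no definition, no named fact, no `axiom`, no `sorry`). Sequel of
`SchrodingerLeraySectionSmooth.lean` (same three-step architecture: standard model `ℓ_Y`, any Lagrangian by
rigidity, any Gram duality by transport).

**The statement** ([Rangarao1993] Lemma 3.2 (1), (3.8), Thm 3.5: on the Siegel parabolic `P(Y)` the Weil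
representation is `(r(p)Φ)(x) = |det(p|_Y)|^{1/2} ψ(…) Φ(x a)`, so at the origin `(r(p)Φ)(0) = |det(p|_Y)|^{1/2} Φ(0)`;
[MoeglinVignerasWaldspurger1987] Chap. 2 II.6). Let `F` be a non-archimedean local field of characteristic `0`, `ψ`
a non-trivial continuous character, `W = F^ι × F^ι` with a Gram duality `β_T(x, y) = ⟨x, T y⟩` (`det T` a unit),
`ρ_T = schrodingerSB β_T ψ` the smooth Schrödinger model on `𝒮(F^ι)`, `ℓ` ANY Lagrangian of `A_T = alt (polar β_T)`,
`r` THE normalised section of implementers of `ρ_T` whose multiplier is the Leray cocycle `c^{ψ(½·)}_ℓ`, and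
`δ ∈ Sp(W, A_T)` an element carrying `ℓ` ONTO `ℓ_Y = 0 ⊕ F^ι`. Then for every `g ∈ Sp(W, A_T)` with `g ℓ = ℓ` and every
`Φ ∈ 𝒮(F^ι)`:

  `((r(δ) r(g) r(δ)⁻¹) Φ)(0) = |det(g|_ℓ)|^{1/2} · Φ(0)`     (`apply_zero_conj_eq_gram`),

`g|_ℓ : ℓ → ℓ` the restriction and `|·|` the normalised absolute value `normAbs F`. (The exponent is `+½` on `det(g|_ℓ)`:
functions live on `X`, the parabolic stabilises the complementary `Y`.)

**Proof.** §1 standard model (`T = 1`, `ℓ = ℓ_Y`, self-dual measure): `q ∈ P_{ℓ_Y}` is `m(a) n(c)` with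
`q|_{ℓ_Y} = ᵗa⁻¹` (`exists_eq_leviSp_mul_unipotentSp`), `r(q) = leviOpPi a ∘ unipOpPi c`
(`schrodingerLeraySection_leviSp_mul_unipotentSp`), and `(leviOpPi a Ψ)(0) = |det a|^{-1/2} Ψ(0) = |det ᵗa⁻¹|^{1/2} Ψ(0)`,
`(unipOpPi c Ψ)(0) = Ψ(0)`. §2 any Lagrangian `ℓ` with `δ ℓ = ℓ_Y`: by rigidity (`leraySection_apply_conj`, `Sp`
perfect in characteristic `0`) `r(δ) r(g) r(δ)⁻¹ = r_Y(δ g δ⁻¹)` with `r_Y` the Schrödinger–Leray section, and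
`det((δgδ⁻¹)|_{ℓ_Y}) = det(g|_ℓ)` (conjugate by `δ|_ℓ : ℓ ≃ ℓ_Y`). §3 the Gram duality `β_T`: pull back along
`e_T : (x, y) ↦ (x, T y)` (`ImplementerSection.transport`), which fixes `ℓ_Y` and conjugates restrictions.

Written for GR-1's junction `L8` ("parabolic normalisation" `(M_δ (ω_v(p) (M_δ⁻¹ Φ)))(0) = χ_v(det_Δ p) |det_Δ p|^{1/2} Φ(0)`)
of the local splitting skeleton of [GelbartRogawski1991, Prop. 3.1.1] (stage-1 cell `pub-hodgecm`, menu item «D6»).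
Nothing here is a claim of the manuscripts adjudicated there.

## References

* R. Ranga Rao, *On some explicit formulas in the theory of Weil representation*, Pacific J. Math. 157 (1993)
  335–371: Lemma 3.2 (1), (3.8) p. 351, Thm 3.5 p. 355, Thm 4.1, Lemma 5.1 [Rangarao1993].
* C. Mœglin, M.-F. Vignéras, J.-L. Waldspurger, *Correspondances de Howe sur un corps p-adique*, LNM 1291 (1987),
  Chap. 2 II.6 [MoeglinVignerasWaldspurger1987].
* A. Weil, *Sur certains groupes d'opérateurs unitaires*, Acta Math. 111 (1964): n° 13 [Weil1964].
-/

set_option autoImplicit false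

noncomputable section

namespace Literature.RepresentationTheory.HeisenbergGroup

open _root_.MeasureTheory Matrix Topology Filter ValuativeRel
open Literature.GroupTheory Literature.NumberTheory.Automorphic
open Literature.NumberTheory.GaloisRepresentations.IsNonarchimedeanLocalField
open Literature.NumberTheory.Weil1964 Literature.LinearAlgebra.QuadraticForm

/-! ## §0 Determinants of restrictions are conjugation invariant -/

section Det

variable {F : Type*} [CommRing F] {V V' : Type*} [AddCommGroup V] [Module F V] [AddCommGroup V'] [Module F V']

/-- `det(f'|_{p'}) = det(f|_p)` when `e p = p'` and `f' ∘ e = e ∘ f` for a linear isomorphism `e : V ≃ V'`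
(conjugate by `e|_p : p ≃ p'`). [folklore] -/
private theorem det_restrict_eq_of_conj (e : V ≃ₗ[F] V') {p : Submodule F V} {p' : Submodule F V'}
    (hp : Submodule.map (e : V →ₗ[F] V') p = p') {f : V →ₗ[F] V} {f' : V' →ₗ[F] V'}
    (hf : ∀ x ∈ p, f x ∈ p) (hf' : ∀ x ∈ p', f' x ∈ p') (hconj : ∀ v, f' (e v) = e (f v)) :
    LinearMap.det (f'.restrict hf') = LinearMap.det (f.restrict hf) := by
  let E : p ≃ₗ[F] p' := (e.submoduleMap p).trans (LinearEquiv.ofEq _ _ hp)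
  have key : f'.restrict hf' = (E : p →ₗ[F] p') ∘ₗ f.restrict hf ∘ₗ (E.symm : p' →ₗ[F] p) := by
    apply LinearMap.ext
    intro x
    apply Subtype.ext
    have hx : (E.symm x : V) = e.symm (x : V') := by
      simp only [E, LinearEquiv.trans_symm, LinearEquiv.trans_apply, LinearEquiv.ofEq_symm,
        LinearEquiv.coe_ofEq_apply, LinearEquiv.submoduleMap_symm_apply]
    have hE : ∀ y : p, ((E y : p') : V') = e (y : V) := fun y => by
      simp only [E, LinearEquiv.trans_apply, LinearEquiv.coe_ofEq_apply, LinearEquiv.submoduleMap_apply]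
    rw [LinearMap.coe_restrict_apply, LinearMap.comp_apply, LinearMap.comp_apply, LinearEquiv.coe_coe,
      LinearEquiv.coe_coe, hE, LinearMap.coe_restrict_apply, hx, ← hconj, LinearEquiv.apply_symm_apply]
  rw [key, LinearMap.det_conj]

end Det

/-! ## §1 The standard model: `(r_Y(q) Ψ)(0) = |det(q|_{ℓ_Y})|^{1/2} Ψ(0)` for `q ∈ P_{ℓ_Y}` -/

section PiY

variable {F : Type*} [Field F] [ValuativeRel F] [TopologicalSpace F] [IsNonarchimedeanLocalField F]
  {ι : Type*} [Fintype ι] [DecidableEq ι] [Invertible (2 : F)]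
  {ψ : AddChar F Circle} (hl : IsLocallyConstant (⇑ψ : F → Circle))
  (hb : ∀ y : ι → F, Continuous fun u : ι → F => dotProductBilin F F u y)
  [MeasurableSpace F] [BorelSpace F] (μ : Measure F) [μ.IsAddHaarMeasure] {m : ℤ}

/-- **VALUE AT THE ORIGIN ON THE SIEGEL PARABOLIC (standard model)**: for `q ∈ P_{ℓ_Y}` and `Ψ ∈ 𝒮(F^ι)`,
`(r_Y(q) Ψ)(0) = |det(q|_{ℓ_Y})|^{1/2} Ψ(0)` — `q = m(a) n(c)`, `q|_{ℓ_Y} = ᵗa⁻¹`, `r_Y(q) = leviOpPi a ∘ unipOpPi c` and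
`(leviOpPi a Ψ)(0) = |det a|^{-1/2} Ψ(0)`. [cite: Rangarao1993, Lemma 3.2 (1), (3.8), p. 351; Thm 3.5 (3), p. 355] -/
theorem schrodingerLeraySection_apply_zero_of_parabolic (hψ : ψ.IsContinuousNontrivial) (hm : ψ.HasConductorExp m)
    (hμ : IsSelfDualMeasure ψ μ) (q : (symplecticGroup (polar (dotProductBilin F F (m := ι)))))
    (hq : Submodule.map ((q : ((ι → F) × (ι → F)) ≃ₗ[F] ((ι → F) × (ι → F))) : ((ι → F) × (ι → F)) →ₗ[F] ((ι → F) × (ι → F))) (Submodule.prod (⊥ : Submodule F (ι → F)) (⊤ : Submodule F (ι → F))) = (Submodule.prod (⊥ : Submodule F (ι → F)) (⊤ : Submodule F (ι → F))))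
    (Ψ : SchwartzBruhat (ι → F)) :
    ((schrodingerLeraySection hl μ hψ hm hμ q Ψ : SchwartzBruhat (ι → F)) : (ι → F) → ℂ) 0 =
      (Real.sqrt (normAbs F (LinearMap.det
        (((q : ((ι → F) × (ι → F)) ≃ₗ[F] ((ι → F) × (ι → F))) : ((ι → F) × (ι → F)) →ₗ[F] ((ι → F) × (ι → F))).restrict
          (p := Submodule.prod (⊥ : Submodule F (ι → F)) (⊤ : Submodule F (ι → F)))
          (q := Submodule.prod (⊥ : Submodule F (ι → F)) (⊤ : Submodule F (ι → F)))
          fun _ hx => hq.le (Submodule.mem_map_of_mem hx)))) : ℂ) * (Ψ : (ι → F) → ℂ) 0 := by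
  obtain ⟨a, c, hc, -, -, hq'⟩ := exists_eq_leviSp_mul_unipotentSp q hq
  -- `q|_{ℓ_Y} = ᵗa⁻¹` (conjugate by `y ↦ (0, y)`)
  have hqY : ∀ y : ι → F, (q : ((ι → F) × (ι → F)) ≃ₗ[F] ((ι → F) × (ι → F))) (0, y) = (0, dualLeviPi a y) := fun y => by
    rw [hq', Subgroup.coe_mul, LinearEquiv.mul_apply, coe_unipotentSp, unipotentσ_apply, coe_leviSp_apply]
    simp only [map_zero, add_zero]
  let eY : (ι → F) ≃ₗ[F] (Submodule.prod (⊥ : Submodule F (ι → F)) (⊤ : Submodule F (ι → F))) :=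
    { toFun := fun y => ⟨(0, y), (mem_prod_bot_top_iff _).2 rfl⟩
      invFun := fun p => (p : ((ι → F) × (ι → F))).2
      map_add' := fun y y' => Subtype.ext (Prod.ext (by simp) rfl)
      map_smul' := fun t y => Subtype.ext (Prod.ext (by simp) rfl)
      left_inv := fun y => rfl
      right_inv := fun p => Subtype.ext (Prod.ext ((mem_prod_bot_top_iff _).1 p.2).symm rfl) }
  have hdet : LinearMap.det
      (((q : ((ι → F) × (ι → F)) ≃ₗ[F] ((ι → F) × (ι → F))) : ((ι → F) × (ι → F)) →ₗ[F] ((ι → F) × (ι → F))).restrict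
        (p := Submodule.prod (⊥ : Submodule F (ι → F)) (⊤ : Submodule F (ι → F)))
        (q := Submodule.prod (⊥ : Submodule F (ι → F)) (⊤ : Submodule F (ι → F)))
        fun _ hx => hq.le (Submodule.mem_map_of_mem hx)) =
      LinearMap.det ((dualLeviPi a : (ι → F) ≃ₗ[F] (ι → F)) : (ι → F) →ₗ[F] (ι → F)) := by
    rw [← LinearMap.det_conj ((dualLeviPi a : (ι → F) ≃ₗ[F] (ι → F)) : (ι → F) →ₗ[F] (ι → F)) eY]
    congr 1
    apply LinearMap.ext
    intro p
    apply Subtype.ext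
    have hp : (p : ((ι → F) × (ι → F))) = (0, (p : ((ι → F) × (ι → F))).2) :=
      Prod.ext ((mem_prod_bot_top_iff _).1 p.2) rfl
    rw [LinearMap.coe_restrict_apply]
    change (q : ((ι → F) × (ι → F)) ≃ₗ[F] ((ι → F) × (ι → F))) (p : ((ι → F) × (ι → F))) =
      (0, dualLeviPi a (p : ((ι → F) × (ι → F))).2)
    conv_lhs => rw [hp]
    rw [hqY]
  -- the operator and its value at `0`
  have hop : schrodingerLeraySection hl μ hψ hm hμ q = leviOpPi a * unipOpPi hl c := by
    rw [hq']
    exact schrodingerLeraySection_leviSp_mul_unipotentSp hl μ hψ hm hμ a c hc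
  have h0 : halfForm c (0 : ι → F) = 0 := by
    rw [halfForm_apply, map_zero, zero_dotProduct, mul_zero]
  rw [hop, LinearEquiv.mul_apply, coe_leviOpPi_apply, map_zero, coe_unipOpPi_apply, h0, neg_zero,
    AddChar.map_zero_eq_one, Circle.coe_one, one_mul, hdet, ← Complex.ofReal_inv, ← modSqrt_dualLeviPi]
  rfl

variable [CharZero F]

/-! ## §2 Any Lagrangian `ℓ` of the standard form, carried onto `ℓ_Y` by `δ` -/

/-- **VALUE AT THE ORIGIN OF THE CONJUGATED LERAY SECTION (standard duality, any Lagrangian)**: if the cocycle of the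
normalised section `r` of `ρ = schrodingerSB ⟨·,·⟩ ψ` is the Leray cocycle `c^{ψ(½·)}_ℓ`, `δ ∈ Sp` carries `ℓ` onto
`ℓ_Y` and `g ∈ Sp` stabilises `ℓ`, then `((r(δ) r(g) r(δ)⁻¹) Φ)(0) = |det(g|_ℓ)|^{1/2} Φ(0)` — by rigidity
`r(δ) r(g) r(δ)⁻¹ = r_Y(δ g δ⁻¹)` (`leraySection_apply_conj`) and §1 at `q = δ g δ⁻¹ ∈ P_{ℓ_Y}`,
`det(q|_{ℓ_Y}) = det(g|_ℓ)`. [cite: Rangarao1993, Lemma 3.2 (1), Thm 3.5, Thm 4.1, Lemma 5.1; MoeglinVignerasWaldspurger1987, Chap. 2 II.6] -/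
theorem apply_zero_conj_eq_pi (hψ : ψ.IsContinuousNontrivial)
    (hU : ImplementerUniqueUpToScalar (schrodingerSB (dotProductBilin F F (m := ι)) ψ hl hb))
    (r : ImplementerSection (schrodingerSB (dotProductBilin F F (m := ι)) ψ hl hb))
    {ℓ : Submodule F ((ι → F) × (ι → F))} (hℓ : LinearMap.BilinForm.orthogonal (alt (polar (dotProductBilin F F (m := ι)))) ℓ = ℓ)
    (hr : r.cocycle hU = lerayCentralCocycle μ (isContinuousNontrivial_mulShift_half hψ)
      (isAlt_alt_polar_dotProductBilin (F := F) (ι := ι)) nondegenerate_alt_polar_dotProductBilin hℓ)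
    (δ : (symplecticGroup (polar (dotProductBilin F F (m := ι)))))
    (hδ : Submodule.map ((δ : ((ι → F) × (ι → F)) ≃ₗ[F] ((ι → F) × (ι → F))) : ((ι → F) × (ι → F)) →ₗ[F] ((ι → F) × (ι → F))) ℓ = (Submodule.prod (⊥ : Submodule F (ι → F)) (⊤ : Submodule F (ι → F))))
    (g : (symplecticGroup (polar (dotProductBilin F F (m := ι)))))
    (hg : Submodule.map ((g : ((ι → F) × (ι → F)) ≃ₗ[F] ((ι → F) × (ι → F))) : ((ι → F) × (ι → F)) →ₗ[F] ((ι → F) × (ι → F))) ℓ = ℓ)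
    (Φ : SchwartzBruhat (ι → F)) :
    (((r δ * r g * (r δ)⁻¹) Φ : SchwartzBruhat (ι → F)) : (ι → F) → ℂ) 0 =
      (Real.sqrt (normAbs F (LinearMap.det
        (((g : ((ι → F) × (ι → F)) ≃ₗ[F] ((ι → F) × (ι → F))) : ((ι → F) × (ι → F)) →ₗ[F] ((ι → F) × (ι → F))).restrict
          (p := ℓ) (q := ℓ) fun _ hx => hg.le (Submodule.mem_map_of_mem hx)))) : ℂ) * (Φ : (ι → F) → ℂ) 0 := by
  have hA := isAlt_alt_polar_dotProductBilin (F := F) (ι := ι)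
  have hN := nondegenerate_alt_polar_dotProductBilin (F := F) (ι := ι)
  have hψ' := isContinuousNontrivial_mulShift_half (F := F) hψ
  -- the Schrödinger–Leray section `r_Y` (self-dual measure, conductor exponent)
  obtain ⟨m₀, hm₀⟩ := hψ.exists_hasConductorExp
  obtain ⟨μ₀, hμ₀, hsd⟩ := exists_isSelfDualMeasure hψ
  haveI := hμ₀
  have hY : (schrodingerLerayImplementerSection hl hb μ₀ hψ hm₀ hsd).cocycle hU =
      lerayCentralCocycle μ₀ hψ' hA hN orthogonal_prod_bot_top := by
    have h := schrodingerCocyclePi_eq_lerayCentralCocycle hl hb μ₀ hψ hm₀ hsd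
    rw [schrodingerCocyclePi_def] at h
    exact h
  -- `c_{r_Y} = c_{δ ℓ}` for the measure `μ`
  have hY' : (schrodingerLerayImplementerSection hl hb μ₀ hψ hm₀ hsd).cocycle hU =
      lerayCentralCocycle μ hψ' hA hN (orthogonal_map_symplectic_eq_self hN hℓ δ) := by
    rw [hY]
    refine CentralCocycle.ext fun g₁ g₂ => Units.ext ?_
    rw [lerayCentralCocycle_apply, lerayCentralCocycle_apply]
    change lerayCocycle (ψ.mulShift (⅟(2 : F))) μ₀ (alt (polar (dotProductBilin F F (m := ι))))
        (Submodule.prod (⊥ : Submodule F (ι → F)) (⊤ : Submodule F (ι → F))) (g₁ : ((ι → F) × (ι → F)) ≃ₗ[F] ((ι → F) × (ι → F))) (g₂ : ((ι → F) × (ι → F)) ≃ₗ[F] ((ι → F) × (ι → F))) =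
      lerayCocycle (ψ.mulShift (⅟(2 : F))) μ (alt (polar (dotProductBilin F F (m := ι))))
        (ℓ.map ((δ : ((ι → F) × (ι → F)) ≃ₗ[F] ((ι → F) × (ι → F))) : ((ι → F) × (ι → F)) →ₗ[F] ((ι → F) × (ι → F)))) (g₁ : ((ι → F) × (ι → F)) ≃ₗ[F] ((ι → F) × (ι → F))) (g₂ : ((ι → F) × (ι → F)) ≃ₗ[F] ((ι → F) × (ι → F)))
    rw [hδ]
    exact lerayCocycle_eq_of_isAddHaarMeasure μ μ₀ hψ' _ _ _ _
  -- rigidity: `r_Y(δ g δ⁻¹) = r(δ) r(g) r(δ)⁻¹`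
  have hconj := leraySection_apply_conj μ monoidHom_symplecticGroup_pi_eq_one hψ' hA hN hℓ δ hU
    r (schrodingerLerayImplementerSection hl hb μ₀ hψ hm₀ hsd) hr hY' g
  -- `q = δ g δ⁻¹ ∈ P_{ℓ_Y}`
  set q : (symplecticGroup (polar (dotProductBilin F F (m := ι)))) := δ * g * δ⁻¹ with hq_def
  have hcoe : ∀ v, (q : ((ι → F) × (ι → F)) ≃ₗ[F] ((ι → F) × (ι → F))) v =
      (δ : ((ι → F) × (ι → F)) ≃ₗ[F] ((ι → F) × (ι → F))) ((g : ((ι → F) × (ι → F)) ≃ₗ[F] ((ι → F) × (ι → F)))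
        ((δ : ((ι → F) × (ι → F)) ≃ₗ[F] ((ι → F) × (ι → F))).symm v)) := fun v => by
    simp only [hq_def, Subgroup.coe_mul, Subgroup.coe_inv, LinearEquiv.mul_apply, LinearEquiv.coe_inv]
  have hback : Submodule.map ((δ : ((ι → F) × (ι → F)) ≃ₗ[F] ((ι → F) × (ι → F))).symm : ((ι → F) × (ι → F)) →ₗ[F] ((ι → F) × (ι → F)))
      (Submodule.prod (⊥ : Submodule F (ι → F)) (⊤ : Submodule F (ι → F))) = ℓ := by
    rw [← hδ, ← Submodule.map_comp]
    have e2 : ((δ : ((ι → F) × (ι → F)) ≃ₗ[F] ((ι → F) × (ι → F))).symm : ((ι → F) × (ι → F)) →ₗ[F] ((ι → F) × (ι → F))) ∘ₗ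
        ((δ : ((ι → F) × (ι → F)) ≃ₗ[F] ((ι → F) × (ι → F))) : ((ι → F) × (ι → F)) →ₗ[F] ((ι → F) × (ι → F))) = LinearMap.id :=
      LinearMap.ext fun v => (δ : ((ι → F) × (ι → F)) ≃ₗ[F] ((ι → F) × (ι → F))).symm_apply_apply v
    rw [e2, Submodule.map_id]
  have hq : Submodule.map ((q : ((ι → F) × (ι → F)) ≃ₗ[F] ((ι → F) × (ι → F))) : ((ι → F) × (ι → F)) →ₗ[F] ((ι → F) × (ι → F)))
      (Submodule.prod (⊥ : Submodule F (ι → F)) (⊤ : Submodule F (ι → F))) =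
      (Submodule.prod (⊥ : Submodule F (ι → F)) (⊤ : Submodule F (ι → F))) := by
    have e1 : ((q : ((ι → F) × (ι → F)) ≃ₗ[F] ((ι → F) × (ι → F))) : ((ι → F) × (ι → F)) →ₗ[F] ((ι → F) × (ι → F))) =
        ((δ : ((ι → F) × (ι → F)) ≃ₗ[F] ((ι → F) × (ι → F))) : ((ι → F) × (ι → F)) →ₗ[F] ((ι → F) × (ι → F))) ∘ₗ
          ((g : ((ι → F) × (ι → F)) ≃ₗ[F] ((ι → F) × (ι → F))) : ((ι → F) × (ι → F)) →ₗ[F] ((ι → F) × (ι → F))) ∘ₗ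
          ((δ : ((ι → F) × (ι → F)) ≃ₗ[F] ((ι → F) × (ι → F))).symm : ((ι → F) × (ι → F)) →ₗ[F] ((ι → F) × (ι → F))) :=
      LinearMap.ext fun v => hcoe v
    rw [e1, Submodule.map_comp, Submodule.map_comp, hback, hg, hδ]
  -- `det(q|_{ℓ_Y}) = det(g|_ℓ)`
  have hdet : LinearMap.det
      (((q : ((ι → F) × (ι → F)) ≃ₗ[F] ((ι → F) × (ι → F))) : ((ι → F) × (ι → F)) →ₗ[F] ((ι → F) × (ι → F))).restrict
        (p := Submodule.prod (⊥ : Submodule F (ι → F)) (⊤ : Submodule F (ι → F)))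
        (q := Submodule.prod (⊥ : Submodule F (ι → F)) (⊤ : Submodule F (ι → F)))
        fun _ hx => hq.le (Submodule.mem_map_of_mem hx)) =
      LinearMap.det (((g : ((ι → F) × (ι → F)) ≃ₗ[F] ((ι → F) × (ι → F))) : ((ι → F) × (ι → F)) →ₗ[F] ((ι → F) × (ι → F))).restrict
        (p := ℓ) (q := ℓ) fun _ hx => hg.le (Submodule.mem_map_of_mem hx)) :=
    det_restrict_eq_of_conj (δ : ((ι → F) × (ι → F)) ≃ₗ[F] ((ι → F) × (ι → F))) hδ _ _ fun v => by
      rw [LinearEquiv.coe_coe, LinearEquiv.coe_coe, hcoe, LinearEquiv.symm_apply_apply]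
  rw [← hconj, schrodingerLerayImplementerSection_apply,
    schrodingerLeraySection_apply_zero_of_parabolic hl μ₀ hψ hm₀ hsd q hq Φ, hdet]

end PiY

/-! ## §3 The Gram duality `β_T(x, y) = ⟨x, T y⟩` -/

section Gram

variable {F : Type*} [Field F] [ValuativeRel F] [TopologicalSpace F] [IsNonarchimedeanLocalField F] [CharZero F]
  {ι : Type*} [Fintype ι] [DecidableEq ι] [Invertible (2 : F)] (T : Matrix ι ι F) (hT : IsUnit T.det)
  {ψ : AddChar F Circle} (hl : IsLocallyConstant (⇑ψ : F → Circle))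
  (hbT : ∀ y : ι → F, Continuous fun u : ι → F => Matrix.toLinearMap₂' F T u y)
  [MeasurableSpace F] [BorelSpace F] (μ : Measure F) [μ.IsAddHaarMeasure]

omit [ValuativeRel F] [TopologicalSpace F] [IsNonarchimedeanLocalField F] [CharZero F] [Invertible (2 : F)]
  [MeasurableSpace F] [BorelSpace F] in
/-- `e_T : (x, y) ↦ (x, T y)` fixes `ℓ_Y = 0 ⊕ F^ι`. [cite: Weil1964, n° 34, p. 182] -/
theorem map_gramProd_prod_bot_top :
    Submodule.map ((gramProd T hT : ((ι → F) × (ι → F)) ≃ₗ[F] ((ι → F) × (ι → F))) : ((ι → F) × (ι → F)) →ₗ[F] ((ι → F) × (ι → F)))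
      (Submodule.prod (⊥ : Submodule F (ι → F)) (⊤ : Submodule F (ι → F))) =
      (Submodule.prod (⊥ : Submodule F (ι → F)) (⊤ : Submodule F (ι → F))) := by
  refine le_antisymm ?_ fun v hv => ?_
  · rintro _ ⟨w, hw, rfl⟩
    rw [SetLike.mem_coe, mem_prod_bot_top_iff] at hw
    rw [mem_prod_bot_top_iff, LinearEquiv.coe_coe, gramProd_apply]
    exact hw
  · refine ⟨(gramProd T hT).symm v, ?_, (gramProd T hT).apply_symm_apply v⟩
    rw [mem_prod_bot_top_iff] at hv
    rw [SetLike.mem_coe, mem_prod_bot_top_iff]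
    have h := congrArg Prod.fst ((gramProd T hT).apply_symm_apply v)
    rw [gramProd_apply] at h
    exact h.trans hv

/-- **VALUE AT THE ORIGIN OF THE CONJUGATED LERAY SECTION** for the Schrödinger model `ρ_T = schrodingerSB β_T ψ` of a
Gram duality (`det T` a unit) and ANY Lagrangian `ℓ` of `A_T`: if the cocycle of the normalised section `r` is the
Leray cocycle `c^{ψ(½·)}_ℓ` (Rao's Theorem 4.1 (5)), `δ ∈ Sp(W, A_T)` carries `ℓ` onto `ℓ_Y = 0 ⊕ F^ι` and
`g ∈ Sp(W, A_T)` stabilises `ℓ`, then for every `Φ ∈ 𝒮(F^ι)`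

  `((r(δ) r(g) r(δ)⁻¹) Φ)(0) = |det(g|_ℓ)|^{1/2} Φ(0)`.

Pull-back of §2 along `e_T : (x, y) ↦ (x, T y)`. [cite: Rangarao1993, Lemma 3.2 (1), (3.8), Thm 3.5, Thm 4.1; MoeglinVignerasWaldspurger1987, Chap. 2 II.6] -/
theorem apply_zero_conj_eq_gram (hψ : ψ.IsContinuousNontrivial)
    (hU : ImplementerUniqueUpToScalar (schrodingerSB (Matrix.toLinearMap₂' F T) ψ hl hbT))
    (r : ImplementerSection (schrodingerSB (Matrix.toLinearMap₂' F T) ψ hl hbT))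
    {ℓ : Submodule F ((ι → F) × (ι → F))} (hℓ : LinearMap.BilinForm.orthogonal (alt (polar (Matrix.toLinearMap₂' F T))) ℓ = ℓ)
    (hr : r.cocycle hU = lerayCentralCocycle μ (isContinuousNontrivial_mulShift_half hψ) (isAlt_alt_polar_gram T)
      (nondegenerate_alt_polar_gram T hT) hℓ)
    (δ : (symplecticGroup (polar (Matrix.toLinearMap₂' F T))))
    (hδ : Submodule.map ((δ : ((ι → F) × (ι → F)) ≃ₗ[F] ((ι → F) × (ι → F))) : ((ι → F) × (ι → F)) →ₗ[F] ((ι → F) × (ι → F))) ℓ = (Submodule.prod (⊥ : Submodule F (ι → F)) (⊤ : Submodule F (ι → F))))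
    (g : (symplecticGroup (polar (Matrix.toLinearMap₂' F T))))
    (hg : Submodule.map ((g : ((ι → F) × (ι → F)) ≃ₗ[F] ((ι → F) × (ι → F))) : ((ι → F) × (ι → F)) →ₗ[F] ((ι → F) × (ι → F))) ℓ = ℓ)
    (Φ : SchwartzBruhat (ι → F)) :
    (((r δ * r g * (r δ)⁻¹) Φ : SchwartzBruhat (ι → F)) : (ι → F) → ℂ) 0 =
      (Real.sqrt (normAbs F (LinearMap.det
        (((g : ((ι → F) × (ι → F)) ≃ₗ[F] ((ι → F) × (ι → F))) : ((ι → F) × (ι → F)) →ₗ[F] ((ι → F) × (ι → F))).restrict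
          (p := ℓ) (q := ℓ) fun _ hx => hg.le (Submodule.mem_map_of_mem hx)))) : ℂ) * (Φ : (ι → F) → ℂ) 0 := by
  have hψ' := isContinuousNontrivial_mulShift_half (F := F) hψ
  set e := gramProd T hT with he_def
  have hpol := polar_dotProductBilin_gramProd T hT
  have hA : ∀ v w : ((ι → F) × (ι → F)), (alt (polar (dotProductBilin F F (m := ι)))) (e v) (e w) = (alt (polar (Matrix.toLinearMap₂' F T))) v w := alt_polar_dotProductBilin_gramProd T hT
  have hA' : ∀ v w : ((ι → F) × (ι → F)), (alt (polar (Matrix.toLinearMap₂' F T))) (e.symm v) (e.symm w) = (alt (polar (dotProductBilin F F (m := ι)))) v w := fun v w => by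
    rw [← hA, LinearEquiv.apply_symm_apply, LinearEquiv.apply_symm_apply]
  have hb : ∀ y : ι → F, Continuous fun u : ι → F => dotProductBilin F F u y := continuous_dotProductBilin_left
  have hρ := schrodingerSB_gram_eq T hT hl hb hbT (ψ := ψ)
  have hU1 := implementerUniqueUpToScalar_schrodingerSB_pi hl hb hψ
  -- pull `r` back to the standard model along `e⁻¹`
  have hpol' : ∀ v w : ((ι → F) × (ι → F)), polar (Matrix.toLinearMap₂' F T) (e.symm v) (e.symm w) = polar (dotProductBilin F F) v w :=
    form_symm_symm e hpol
  have hρ' : ∀ a : Heisenberg (polar (dotProductBilin F F (m := ι))),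
      schrodingerSB (dotProductBilin F F) ψ hl hb a =
        schrodingerSB (Matrix.toLinearMap₂' F T) ψ hl hbT (Heisenberg.mapEquiv e.symm hpol' a) := fun a => by
    rw [hρ]
    congr 1
    apply Heisenberg.ext
    · rw [Heisenberg.mapEquiv_v, Heisenberg.mapEquiv_v, LinearEquiv.apply_symm_apply]
    · rfl
  set r₁ := ImplementerSection.transport e.symm hpol' hρ' r with hr₁_def
  -- its cocycle is the Leray cocycle of `e ℓ`
  have hℓ₁ : LinearMap.BilinForm.orthogonal (alt (polar (dotProductBilin F F (m := ι)))) (ℓ.map (e : ((ι → F) × (ι → F)) →ₗ[F] ((ι → F) × (ι → F)))) = ℓ.map (e : ((ι → F) × (ι → F)) →ₗ[F] ((ι → F) × (ι → F))) :=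
    orthogonal_map_equiv_eq_self e hA hℓ
  have hback : (ℓ.map (e : ((ι → F) × (ι → F)) →ₗ[F] ((ι → F) × (ι → F)))).map (e.symm : ((ι → F) × (ι → F)) →ₗ[F] ((ι → F) × (ι → F))) = ℓ := by
    have e2 : (e.symm : ((ι → F) × (ι → F)) →ₗ[F] ((ι → F) × (ι → F))) ∘ₗ (e : ((ι → F) × (ι → F)) →ₗ[F] ((ι → F) × (ι → F))) = LinearMap.id := LinearMap.ext fun v => e.symm_apply_apply v
    rw [← Submodule.map_comp, e2, Submodule.map_id]
  have hr₁ : r₁.cocycle hU1 = lerayCentralCocycle μ hψ' (isAlt_alt_polar_dotProductBilin (F := F) (ι := ι))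
      nondegenerate_alt_polar_dotProductBilin hℓ₁ := by
    refine CentralCocycle.ext fun g₁ g₂ => Units.ext ?_
    rw [hr₁_def, ImplementerSection.cocycle_transport e.symm hpol' hρ' r hU1 hU, hr]
    change lerayCocycle (ψ.mulShift (⅟(2 : F))) μ (alt (polar (Matrix.toLinearMap₂' F T))) ℓ ((symplecticConj e.symm hpol' g₁ : (symplecticGroup (polar (Matrix.toLinearMap₂' F T)))) : ((ι → F) × (ι → F)) ≃ₗ[F] ((ι → F) × (ι → F)))
        ((symplecticConj e.symm hpol' g₂ : (symplecticGroup (polar (Matrix.toLinearMap₂' F T)))) : ((ι → F) × (ι → F)) ≃ₗ[F] ((ι → F) × (ι → F))) =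
      lerayCocycle (ψ.mulShift (⅟(2 : F))) μ (alt (polar (dotProductBilin F F (m := ι)))) (ℓ.map (e : ((ι → F) × (ι → F)) →ₗ[F] ((ι → F) × (ι → F)))) (g₁ : ((ι → F) × (ι → F)) ≃ₗ[F] ((ι → F) × (ι → F))) (g₂ : ((ι → F) × (ι → F)) ≃ₗ[F] ((ι → F) × (ι → F)))
    rw [coe_symplecticConj, coe_symplecticConj, ← lerayCocycle_conj μ e.symm hA' hψ' (ℓ.map (e : ((ι → F) × (ι → F)) →ₗ[F] ((ι → F) × (ι → F)))), hback]
  -- transported elements `x₁ = e x e⁻¹`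
  obtain ⟨δ₁, hδ₁_def⟩ : ∃ x : (symplecticGroup (polar (dotProductBilin F F (m := ι)))), x = (symplecticConj e.symm hpol').symm δ := ⟨_, rfl⟩
  obtain ⟨g₁, hg₁_def⟩ : ∃ x : (symplecticGroup (polar (dotProductBilin F F (m := ι)))), x = (symplecticConj e.symm hpol').symm g := ⟨_, rfl⟩
  have hcoe : ∀ (x : (symplecticGroup (polar (Matrix.toLinearMap₂' F T)))) (v : ((ι → F) × (ι → F))),
      (((symplecticConj e.symm hpol').symm x : (symplecticGroup (polar (dotProductBilin F F (m := ι))))) : ((ι → F) × (ι → F)) ≃ₗ[F] ((ι → F) × (ι → F))) v =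
        e ((x : ((ι → F) × (ι → F)) ≃ₗ[F] ((ι → F) × (ι → F))) (e.symm v)) := fun x v => by
    rw [symplecticConj_symm_apply, LinearEquiv.symm_symm]
  have hmap : ∀ x : (symplecticGroup (polar (Matrix.toLinearMap₂' F T))),
      Submodule.map ((((symplecticConj e.symm hpol').symm x : (symplecticGroup (polar (dotProductBilin F F (m := ι))))) : ((ι → F) × (ι → F)) ≃ₗ[F] ((ι → F) × (ι → F))) : ((ι → F) × (ι → F)) →ₗ[F] ((ι → F) × (ι → F)))
          (ℓ.map (e : ((ι → F) × (ι → F)) →ₗ[F] ((ι → F) × (ι → F)))) =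
        (Submodule.map ((x : ((ι → F) × (ι → F)) ≃ₗ[F] ((ι → F) × (ι → F))) : ((ι → F) × (ι → F)) →ₗ[F] ((ι → F) × (ι → F))) ℓ).map
          (e : ((ι → F) × (ι → F)) →ₗ[F] ((ι → F) × (ι → F))) := fun x => by
    have e1 : ((((symplecticConj e.symm hpol').symm x : (symplecticGroup (polar (dotProductBilin F F (m := ι))))) : ((ι → F) × (ι → F)) ≃ₗ[F] ((ι → F) × (ι → F))) : ((ι → F) × (ι → F)) →ₗ[F] ((ι → F) × (ι → F))) =
        (e : ((ι → F) × (ι → F)) →ₗ[F] ((ι → F) × (ι → F))) ∘ₗ ((x : ((ι → F) × (ι → F)) ≃ₗ[F] ((ι → F) × (ι → F))) : ((ι → F) × (ι → F)) →ₗ[F] ((ι → F) × (ι → F))) ∘ₗ (e.symm : ((ι → F) × (ι → F)) →ₗ[F] ((ι → F) × (ι → F))) :=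
      LinearMap.ext fun v => hcoe x v
    rw [e1, Submodule.map_comp, Submodule.map_comp, hback]
  have hδ₁ : Submodule.map ((δ₁ : ((ι → F) × (ι → F)) ≃ₗ[F] ((ι → F) × (ι → F))) : ((ι → F) × (ι → F)) →ₗ[F] ((ι → F) × (ι → F)))
      (ℓ.map (e : ((ι → F) × (ι → F)) →ₗ[F] ((ι → F) × (ι → F)))) =
      (Submodule.prod (⊥ : Submodule F (ι → F)) (⊤ : Submodule F (ι → F))) := by
    rw [hδ₁_def, hmap, hδ, he_def, map_gramProd_prod_bot_top]
  have hg₁ : Submodule.map ((g₁ : ((ι → F) × (ι → F)) ≃ₗ[F] ((ι → F) × (ι → F))) : ((ι → F) × (ι → F)) →ₗ[F] ((ι → F) × (ι → F)))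
      (ℓ.map (e : ((ι → F) × (ι → F)) →ₗ[F] ((ι → F) × (ι → F)))) = ℓ.map (e : ((ι → F) × (ι → F)) →ₗ[F] ((ι → F) × (ι → F))) := by
    rw [hg₁_def, hmap, hg]
  have hrx : ∀ x : (symplecticGroup (polar (Matrix.toLinearMap₂' F T))), r x = r₁ ((symplecticConj e.symm hpol').symm x) := fun x => by
    rw [hr₁_def, ImplementerSection.transport_apply, MulEquiv.apply_symm_apply]
  -- `det(g₁|_{eℓ}) = det(g|_ℓ)`
  have hdet : LinearMap.det
      (((g₁ : ((ι → F) × (ι → F)) ≃ₗ[F] ((ι → F) × (ι → F))) : ((ι → F) × (ι → F)) →ₗ[F] ((ι → F) × (ι → F))).restrict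
        (p := ℓ.map (e : ((ι → F) × (ι → F)) →ₗ[F] ((ι → F) × (ι → F)))) (q := ℓ.map (e : ((ι → F) × (ι → F)) →ₗ[F] ((ι → F) × (ι → F))))
        fun _ hx => hg₁.le (Submodule.mem_map_of_mem hx)) =
      LinearMap.det (((g : ((ι → F) × (ι → F)) ≃ₗ[F] ((ι → F) × (ι → F))) : ((ι → F) × (ι → F)) →ₗ[F] ((ι → F) × (ι → F))).restrict
        (p := ℓ) (q := ℓ) fun _ hx => hg.le (Submodule.mem_map_of_mem hx)) :=
    det_restrict_eq_of_conj e rfl _ _ fun v => by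
      rw [LinearEquiv.coe_coe, LinearEquiv.coe_coe, hg₁_def, hcoe, LinearEquiv.symm_apply_apply]
  rw [hrx δ, hrx g, ← hδ₁_def, ← hg₁_def, apply_zero_conj_eq_pi hl hb μ hψ hU1 r₁ hℓ₁ hr₁ δ₁ hδ₁ g₁ hg₁ Φ, hdet]

end Gram

end Literature.RepresentationTheory.HeisenbergGroup

end
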